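import Mathlib
import HarnessLib
import Summits.HubbardSuperconductivity.HubbardSuperconductivity.Theorems.KLProgrammeKLRegimeEngineTowerLevNumerics

/-!
# Route `KLProgramme` — crux K3 ENGINE (stmt-HubbardSuperconductivity-20437 `KLRegimeEngineV17F2`), stub (b) v2, THE LEVELS PACKAGE (ℓ), instantiation (I5)-LEV:
# THE TWO REMAINING CHOICES — the block length `d` from the BLOCKING row, the discount `B` from the two AMPLITUDE rows
# (cell gate-hubbard-kl, seat hubbard-kl-k3c3-p2 g14, «(I5)-LEV»; E1-TOWER-BLOCKED §9 «order of choices d → Q → B → ε»; E1's (I5) by the substitute precedent)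

After …LevNumerics / …LevLawOfRows(UV) the numerical residue of the levelled tower law is: the BLOCKING row `max 1 Z · C₂² · max 4 (2τψ) ≤ 2^{d−1}` and the two
AMPLITUDE rows `8·Φ·τ·Y ≤ 1`, `128·e·ψ³·τ⁴·Φ·(W·27⁵·ĉ)·Y ≤ (1−(√2^d)⁻¹)·ρ³` in the λ-free amplitude
`Y = ι₂/(2Q′) + W·Z³·X/(4Q′²) + W·27⁵·(ε/B²)·ĉ·Q′/2`.  At the coupling `λ = B·ε` the import and cell coefficients delivered by (I4)/(I2) are of the form
`ι₂ = ῑ₂/B`, `X = X̄/B²` (a degree-4 size is `O(ε) = O(λ/B)`, a degree-6 size `O(ε²) = O(λ²/B²)`), so `Y ≤ Ȳ/B` with the `B`-FREE amplitude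
`Ȳ := ῑ₂/(2Q′) + W·Z³·X̄/(4Q′²) + W·27⁵·ε·ĉ·Q′/2` (`B ≥ 1`), and both rows hold once `B ≥ B₀ := max 1 (max (8ΦτȲ) (128eψ³τ⁴Φ(W27⁵ĉ)Ȳ/((1−(√2^d)⁻¹)ρ³)))`.

* §1 `towerLevNumerics_exists_blocking` — `∃ d ≥ 2` with the blocking row (powers of `2` are unbounded);
* §2 `towerLevNumerics_Y_le_of_B` — `Y ≤ Ȳ/B`; **`towerLevNumerics_amp_of_le_B`** — `B₀ ≤ B` ⇒ both amplitude rows; `towerLevNumerics_B₀_ge_one`.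
Pure real arithmetic; nothing about the model is asserted; nothing asserts (ℓ), any stub, K3 or superconductivity.
References: Benfatto–Giuliani–Mastropietro 2006 §2.8 (2.83), (2.93)–(2.98) [cite: BenfattoGiulianiMastropietro2006].
-/

noncomputable section

namespace Summit.HubbardSuperconductivity.HubbardSuperconductivity.Theorems.EngineV8

set_option linter.dupNamespace false -- summit = problem name (single-conjunct summit), D-0017

open Real

/-! ## §1 The block length from the blocking row -/

/-- **A block length exists**: for any `Z, C₂, τ, ψ` there is `d ≥ 2` with `max 1 Z · C₂² · max 4 (2τψ) ≤ 2^{d−1}`. [folklore] -/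
theorem towerLevNumerics_exists_blocking (Z C₂ τ ψ : ℝ) : ∃ d : ℕ, 2 ≤ d ∧ max 1 Z * C₂ ^ 2 * max 4 (2 * τ * ψ) ≤ (2 : ℝ) ^ (d - 1) := by
  obtain ⟨n, hn⟩ := pow_unbounded_of_one_lt (max 1 Z * C₂ ^ 2 * max 4 (2 * τ * ψ)) (by norm_num : (1 : ℝ) < 2)
  refine ⟨n + 2, by omega, ?_⟩
  have : (2 : ℝ) ^ n ≤ (2 : ℝ) ^ (n + 2 - 1) := pow_le_pow_right₀ (by norm_num) (by omega)
  exact hn.le.trans this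

/-! ## §2 The discount `B` from the two amplitude rows -/

section Amp

variable {Φ ψ τ W Z ε B ι₂ X ῑ₂ Xb ρ Q' ĉ Y Yb : ℝ} {d : ℕ}

/-- **`Y ≤ Ȳ/B`**: with `ι₂ = ῑ₂/B`, `X = X̄/B²` and `B ≥ 1`, the λ-free amplitude is at most the `B`-free amplitude over `B`. -/
theorem towerLevNumerics_Y_le_of_B (hW : 0 < W) (hZ : 0 < Z) (hε : 0 < ε) (hB : 1 ≤ B) (hXb : 0 ≤ Xb) (hQ' : 0 < Q') (hĉ : 0 < ĉ)
    (hι₂ : ι₂ = ῑ₂ / B) (hX : X = Xb / B ^ 2)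
    (hY : Y = ι₂ / (2 * Q') + W * Z ^ 3 * X / (4 * Q' ^ 2) + W * ((27 : ℝ) ^ 5 * (ε / B ^ 2)) * ĉ * Q' / 2)
    (hYb : Yb = ῑ₂ / (2 * Q') + W * Z ^ 3 * Xb / (4 * Q' ^ 2) + W * ((27 : ℝ) ^ 5 * ε) * ĉ * Q' / 2) :
    Y ≤ Yb / B := by
  have hB0 : 0 < B := lt_of_lt_of_le one_pos hB
  have hBB : B ≤ B ^ 2 := by nlinarith
  have hinv : 1 / B ^ 2 ≤ 1 / B := one_div_le_one_div_of_le hB0 hBB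
  have h1 : ι₂ / (2 * Q') = (ῑ₂ / (2 * Q')) / B := by rw [hι₂]; field_simp
  have h2 : W * Z ^ 3 * X / (4 * Q' ^ 2) ≤ (W * Z ^ 3 * Xb / (4 * Q' ^ 2)) / B := by
    rw [hX]
    have hc : 0 ≤ W * Z ^ 3 * Xb / (4 * Q' ^ 2) := by positivity
    calc W * Z ^ 3 * (Xb / B ^ 2) / (4 * Q' ^ 2) = (W * Z ^ 3 * Xb / (4 * Q' ^ 2)) * (1 / B ^ 2) := by ring
      _ ≤ (W * Z ^ 3 * Xb / (4 * Q' ^ 2)) * (1 / B) := mul_le_mul_of_nonneg_left hinv hc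
      _ = (W * Z ^ 3 * Xb / (4 * Q' ^ 2)) / B := by ring
  have h3 : W * ((27 : ℝ) ^ 5 * (ε / B ^ 2)) * ĉ * Q' / 2 ≤ (W * ((27 : ℝ) ^ 5 * ε) * ĉ * Q' / 2) / B := by
    have hc : 0 ≤ W * ((27 : ℝ) ^ 5 * ε) * ĉ * Q' / 2 := by positivity
    calc W * ((27 : ℝ) ^ 5 * (ε / B ^ 2)) * ĉ * Q' / 2 = (W * ((27 : ℝ) ^ 5 * ε) * ĉ * Q' / 2) * (1 / B ^ 2) := by ring
      _ ≤ (W * ((27 : ℝ) ^ 5 * ε) * ĉ * Q' / 2) * (1 / B) := mul_le_mul_of_nonneg_left hinv hc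
      _ = (W * ((27 : ℝ) ^ 5 * ε) * ĉ * Q' / 2) / B := by ring
  rw [hY, hYb, h1, add_div, add_div]
  linarith

/-- `1 ≤ B₀`. -/
theorem towerLevNumerics_B₀_ge_one (a b : ℝ) : 1 ≤ max 1 (max a b) := le_max_left _ _

/-- **THE AMPLITUDE ROWS FROM `B ≥ B₀`**: with `ι₂ = ῑ₂/B`, `X = X̄/B²` and
`B ≥ max 1 (max (8·Φ·τ·Ȳ) (128·e·ψ³·τ⁴·Φ·(W·27⁵·ĉ)·Ȳ / ((1−(√2^d)⁻¹)·ρ³)))` (`Ȳ` the `B`-free amplitude, `d ≥ 1`, `ρ > 0`): `8·Φ·τ·Y ≤ 1` and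
`128·e·ψ³·τ⁴·Φ·(W·27⁵·ĉ)·Y ≤ (1−(√2^d)⁻¹)·ρ³`. -/
theorem towerLevNumerics_amp_of_le_B (hΦ : 0 ≤ Φ) (hψ : 0 ≤ ψ) (hτ : 0 < τ) (hW : 0 < W) (hZ : 0 < Z) (hε : 0 < ε) (hd : 1 ≤ d) (hρ : 0 < ρ)
    (hῑ₂ : 0 ≤ ῑ₂) (hXb : 0 ≤ Xb) (hQ' : 0 < Q') (hĉ : 0 < ĉ)
    (hι₂ : ι₂ = ῑ₂ / B) (hX : X = Xb / B ^ 2)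
    (hY : Y = ι₂ / (2 * Q') + W * Z ^ 3 * X / (4 * Q' ^ 2) + W * ((27 : ℝ) ^ 5 * (ε / B ^ 2)) * ĉ * Q' / 2)
    (hYb : Yb = ῑ₂ / (2 * Q') + W * Z ^ 3 * Xb / (4 * Q' ^ 2) + W * ((27 : ℝ) ^ 5 * ε) * ĉ * Q' / 2)
    (hB : max 1 (max (8 * Φ * τ * Yb) (128 * exp 1 * ψ ^ 3 * τ ^ 4 * Φ * (W * (27 : ℝ) ^ 5 * ĉ) * Yb / ((1 - (Real.sqrt 2 ^ d)⁻¹) * ρ ^ 3))) ≤ B) :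
    8 * Φ * τ * Y ≤ 1 ∧ 128 * exp 1 * ψ ^ 3 * τ ^ 4 * Φ * (W * (27 : ℝ) ^ 5 * ĉ) * Y ≤ (1 - (Real.sqrt 2 ^ d)⁻¹) * ρ ^ 3 := by
  have hB1 : 1 ≤ B := le_trans (le_max_left _ _) hB
  have hB0 : 0 < B := lt_of_lt_of_le one_pos hB1
  have hr : 0 < 1 - (Real.sqrt 2 ^ d)⁻¹ := one_sub_inv_sqrt_two_pow_pos hd
  have hrρ : 0 < (1 - (Real.sqrt 2 ^ d)⁻¹) * ρ ^ 3 := by positivity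
  have hYb0 : 0 ≤ Yb := by rw [hYb]; positivity
  have hYle : Y ≤ Yb / B := towerLevNumerics_Y_le_of_B hW hZ hε hB1 hXb hQ' hĉ hι₂ hX hY hYb
  have hBa : 8 * Φ * τ * Yb ≤ B := le_trans (le_trans (le_max_left _ _) (le_max_right _ _)) hB
  have hBb : 128 * exp 1 * ψ ^ 3 * τ ^ 4 * Φ * (W * (27 : ℝ) ^ 5 * ĉ) * Yb / ((1 - (Real.sqrt 2 ^ d)⁻¹) * ρ ^ 3) ≤ B :=
    le_trans (le_trans (le_max_right _ _) (le_max_right _ _)) hB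
  have hc1 : 0 ≤ 8 * Φ * τ := by positivity
  have hc2 : 0 ≤ 128 * exp 1 * ψ ^ 3 * τ ^ 4 * Φ * (W * (27 : ℝ) ^ 5 * ĉ) := by positivity
  constructor
  · calc 8 * Φ * τ * Y ≤ 8 * Φ * τ * (Yb / B) := mul_le_mul_of_nonneg_left hYle hc1
      _ = (8 * Φ * τ * Yb) / B := by ring
      _ ≤ 1 := by rw [div_le_one hB0]; exact hBa
  · calc 128 * exp 1 * ψ ^ 3 * τ ^ 4 * Φ * (W * (27 : ℝ) ^ 5 * ĉ) * Y
        ≤ 128 * exp 1 * ψ ^ 3 * τ ^ 4 * Φ * (W * (27 : ℝ) ^ 5 * ĉ) * (Yb / B) := mul_le_mul_of_nonneg_left hYle hc2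
      _ = (128 * exp 1 * ψ ^ 3 * τ ^ 4 * Φ * (W * (27 : ℝ) ^ 5 * ĉ) * Yb) / B := by ring
      _ ≤ (1 - (Real.sqrt 2 ^ d)⁻¹) * ρ ^ 3 := by
          rw [div_le_iff₀ hB0]
          have := (div_le_iff₀ hrρ).1 hBb
          nlinarith

end Amp

end Summit.HubbardSuperconductivity.HubbardSuperconductivity.Theorems.EngineV8

end
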